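import Summits.KontsevichZagierPeriods.Zeta5Search.Certificates.ModRedNKKernel
import Summits.KontsevichZagierPeriods.Zeta5Search.Certificates.VIMLevel2K2
import Summits.KontsevichZagierPeriods.Zeta5Search.Certificates.VIMLevel2NKTerm
import HarnessLib

/-!
# ζ(5) search — brown9 LEVEL 2 (R-NK): the termwise identity of the `n`-shift certificate (cell `pub-zeta5`, certifier `cert-2`)

HONEST FRAMING: systematic search; no irrationality claim unless certified.

The inner double sum of fam-brown9's "vanishing in the middle" leading coefficient is
`R(n,x) = Rsum n x = Σ_{k≤n} sR n x k`, `sR n x k = hR n x k · T(n; P, Q)`, `hR = (−1)^k C(n,k)·C(P,n)`, `P = 3n−x−k`,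
`Q = 2n−k` (cert-1, `Certificates/VIMLevel2K2.lean`; `x = k₃` rational). The ttrl2 lane's certificate for the `n`-SHIFT relation
(R-NK) (`r1c/R_NK.json`, VIM.md §7; data `ModRedNKData`, everything ×5) is
`g(k) = hR n x k · (Ψ₀(n,x,k)·T(n;P,Q) + Ψ₁(n,x,k)·T(n;P+1,Q)) / dden`, `dden = (k+1)·P·(n+1−k)²·(P−n+2)²·(P−n+1)` (`gNK`), and the
TERMWISE identity `η₁₀·sR (n+1) x k + η₀₀·sR n x k + η₀₁·sR n (x+1) k = g(k+1) − g(k)` (`NK_termwise`, for `n ≥ 3`,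
`k ≤ n−1`, `x ∉ ℤ`). PROOF: multiplied by `(n+1)!·(k+1)·dden(k)·dden(k+1)` and divided by the hypergeometric unit
`uNK = (−1)^k C(n+1,k)·fallProd (n−3) (P−1)` (re-attachment lemmas `FNK_hR_*`), the identity is the formal combination `ENK` of
T-symbols evaluated on the true `T`-values, which VANISHES by the kernel's module reduction (`ModRedNKKernel.ENK_eval_zero`).
The summation over `k`, the endpoint terms and the relation (R-NK) for all rational `x` are `ModRedNKSum.lean`.
-/

namespace Summit.KontsevichZagierPeriods.Zeta5Search.Certificates

namespace VIMInner.ModRed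

open Finset
open Summit.KontsevichZagierPeriods.Zeta5Search.PolyReflect
open Summit.KontsevichZagierPeriods.Zeta5Search.SymmetricRecursion (choose_succ_right_cast)

/-! ### The certificate -/

/-- The certificate denominator `dden = (k+1)·P·(n+1−k)²·(P−n+2)²·(P−n+1)`
(`= (k₅+1)(k₃+k₅−3n)(k₅−n−1)²(k₃+k₅−2n−2)²(k₃+k₅−2n−1)` of the lane, same sign). -/
def ddenNK (n : ℕ) (x : ℚ) (k : ℕ) : ℚ :=
  ((k : ℚ) + 1) * pOf n x k * ((n : ℚ) + 1 - k) ^ 2 * (pOf n x k - n + 2) ^ 2 * (pOf n x k - n + 1)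

/-- The certificate `g(k) = hR·(Ψ₀·T(n;P,Q) + Ψ₁·T(n;P+1,Q))/dden` of (R-NK) (×5, like the telescoper data). -/
def gNK (n : ℕ) (x : ℚ) (k : ℕ) : ℚ :=
  hR n x k * (ev3 PsiNK0 n x k * T n (pOf n x k) (qOf n k) + ev3 PsiNK1 n x k * T n (pOf n x k + 1) (qOf n k)) /
    ddenNK n x k

/-! ### The hypergeometric unit at level `n = m+3` and the re-attachment lemmas -/

/-- `pOf (m+4) x k = pOf (m+3) x k + 3`. -/
theorem pOf_nsucc (m : ℕ) (x : ℚ) (k : ℕ) : pOf (m + 4) x k = pOf (m + 3) x k + 3 := by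
  unfold pOf; push_cast; ring

/-- `qOf (m+4) k = qOf (m+3) k + 2`. -/
theorem qOf_nsucc (m : ℕ) (k : ℕ) : qOf (m + 4) k = qOf (m + 3) k + 2 := by
  unfold qOf; push_cast; ring

/-- The unit `u = (−1)^k C(m+4,k)·fallProd m (P−1)` (`P = pOf (m+3) x k`). -/
def uNK (m : ℕ) (x : ℚ) (k : ℕ) : ℚ :=
  (-1) ^ k * (((m + 4).choose k : ℕ) : ℚ) * fallProd m (pOf (m + 3) x k - 1)

/-- `fallProd (m+4) (z+4) = (z+4)(z+3)(z+2)(z+1)·fallProd m z`. -/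
theorem fallProd_four_shift (m : ℕ) (z : ℚ) :
    fallProd (m + 4) (z + 4) = (z + 4) * (z + 3) * (z + 2) * (z + 1) * fallProd m z := by
  rw [show m + 4 = m + 1 + 1 + 1 + 1 by rfl, show z + 4 = z + 1 + 1 + 1 + 1 by ring, fallProd_succ_shift,
    fallProd_succ_shift, fallProd_succ_shift, fallProd_succ_shift]
  ring

/-- `(m+4)!·hR (m+4) x k = u·(P+3)(P+2)(P+1)P`. -/
theorem FNK_hR_up (m : ℕ) (x : ℚ) (k : ℕ) :
    (((m + 4).factorial : ℕ) : ℚ) * hR (m + 4) x k =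
      uNK m x k * ((pOf (m + 3) x k + 3) * (pOf (m + 3) x k + 2) * (pOf (m + 3) x k + 1) * pOf (m + 3) x k) := by
  unfold hR bp uNK
  rw [pOf_nsucc, show pOf (m + 3) x k + 3 = (pOf (m + 3) x k - 1) + 4 by ring, fallProd_four_shift]
  have hf : (((m + 4).factorial : ℕ) : ℚ) ≠ 0 := by positivity
  field_simp
  ring

/-- `(m+4)!·hR (m+3) x k = u·(m+4−k)·P(P−m−1)(P−m−2)`. -/
theorem FNK_hR_00 (m : ℕ) (x : ℚ) (k : ℕ) :
    (((m + 4).factorial : ℕ) : ℚ) * hR (m + 3) x k =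
      uNK m x k * ((((m : ℚ) + 4) - k) * pOf (m + 3) x k * (pOf (m + 3) x k - m - 1) * (pOf (m + 3) x k - m - 2)) := by
  unfold hR bp uNK
  rw [NK.choose_m3, fallProd_succ_pred (m + 2) (pOf (m + 3) x k), fallProd_two m (pOf (m + 3) x k - 1),
    Nat.factorial_succ (m + 3)]
  push_cast
  have hf : (((m + 3).factorial : ℕ) : ℚ) ≠ 0 := by positivity
  have hm : ((m : ℚ) + 4) ≠ 0 := by positivity
  have hm' : ((m : ℚ) + 3 + 1) ≠ 0 := by positivity
  field_simp
  ring

/-- `(m+4)!·hR (m+3) (x+1) k = u·(m+4−k)·(P−m−1)(P−m−2)(P−m−3)`. -/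
theorem FNK_hR_x (m : ℕ) (x : ℚ) (k : ℕ) :
    (((m + 4).factorial : ℕ) : ℚ) * hR (m + 3) (x + 1) k =
      uNK m x k * ((((m : ℚ) + 4) - k) * (pOf (m + 3) x k - m - 1) * (pOf (m + 3) x k - m - 2) *
        (pOf (m + 3) x k - m - 3)) := by
  unfold hR bp uNK
  rw [NK.choose_m3, pOf_xsucc, fallProd_three, Nat.factorial_succ (m + 3)]
  push_cast
  have hf : (((m + 3).factorial : ℕ) : ℚ) ≠ 0 := by positivity
  have hm : ((m : ℚ) + 4) ≠ 0 := by positivity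
  have hm' : ((m : ℚ) + 3 + 1) ≠ 0 := by positivity
  field_simp
  ring

/-- `(m+4)!·(k+1)·hR (m+3) x (k+1) = −u·(m+4−k)(m+3−k)·(P−m−1)(P−m−2)(P−m−3)`. -/
theorem FNK_hR_k (m : ℕ) (x : ℚ) (k : ℕ) :
    (((m + 4).factorial : ℕ) : ℚ) * ((k : ℚ) + 1) * hR (m + 3) x (k + 1) =
      -(uNK m x k * ((((m : ℚ) + 4) - k) * (((m : ℚ) + 3) - k) * (pOf (m + 3) x k - m - 1) *
        (pOf (m + 3) x k - m - 2) * (pOf (m + 3) x k - m - 3))) := by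
  have hk : ((k : ℚ) + 1) ≠ 0 := by positivity
  have hc : (((m + 3).choose (k + 1) : ℕ) : ℚ) =
      (((m + 4).choose k : ℕ) : ℚ) * (((m : ℚ) + 4) - k) * (((m : ℚ) + 3) - k) / (((m : ℚ) + 4) * ((k : ℚ) + 1)) := by
    have h := choose_succ_right_cast (m + 3) k
    push_cast at h
    rw [NK.choose_m3 m k] at h
    have hm : ((m : ℚ) + 4) ≠ 0 := by positivity
    rw [eq_div_iff (mul_ne_zero hm hk)]
    field_simp at h
    linear_combination h
  unfold hR bp uNK
  rw [hc, pOf_ksucc, fallProd_three, Nat.factorial_succ (m + 3)]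
  push_cast
  have hf : (((m + 3).factorial : ℕ) : ℚ) ≠ 0 := by positivity
  have hm : ((m : ℚ) + 4) ≠ 0 := by positivity
  have hm' : ((m : ℚ) + 3 + 1) ≠ 0 := by positivity
  field_simp
  ring

/-! ### The value of the formal combination `ENK` -/

/-- `3n − x − k + c` is not zero for non-integral `x`. -/
theorem pOf_add_ne_zero {x : ℚ} (hx : ∀ z : ℤ, x ≠ z) (n k : ℕ) (c : ℤ) : pOf n x k + c ≠ 0 := by
  intro h
  apply hx (3 * n - k + c)
  unfold pOf at h
  push_cast
  linarith

/-- The explicit value of `lcEval … ENK`: seven terms (`P = pOf n x k`, `Q = qOf n k`). -/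
theorem lcEval_ENK (n : ℕ) (x : ℚ) (k : ℕ) :
    lcEval (Tv tabNK n x k) n x k 0 ENK =
      ev2 etaNK10 n x * (((k : ℚ) + 1) * (pOf n x k + 3) * (pOf n x k + 2) * (pOf n x k + 1) * pOf n x k *
          ((((n : ℚ) + 1) - k) * (pOf n x k - n + 2) * ((k : ℚ) + 2) * (pOf n x k - 1) * ((n : ℚ) - k) *
            (pOf n x k - n + 1))) * T (n + 1) (pOf n x k + 3) (qOf n k + 2)
      + ev2 etaNK00 n x * (((k : ℚ) + 1) * (((n : ℚ) + 1) - k) * pOf n x k * (pOf n x k - n + 2) * (pOf n x k - n + 1) *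
          ((((n : ℚ) + 1) - k) * (pOf n x k - n + 2) * ((k : ℚ) + 2) * (pOf n x k - 1) * ((n : ℚ) - k) *
            (pOf n x k - n + 1))) * T n (pOf n x k) (qOf n k)
      + ev3 PsiNK0 n x k * (((k : ℚ) + 2) * (pOf n x k - 1) * ((n : ℚ) - k) * (pOf n x k - n + 1)) *
          T n (pOf n x k) (qOf n k)
      + ev3 PsiNK1 n x k * (((k : ℚ) + 2) * (pOf n x k - 1) * ((n : ℚ) - k) * (pOf n x k - n + 1)) *
          T n (pOf n x k + 1) (qOf n k)
      + ev2 etaNK01 n x * (((k : ℚ) + 1) * (((n : ℚ) + 1) - k) * (pOf n x k - n + 2) * (pOf n x k - n + 1) * (pOf n x k - n) *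
          ((((n : ℚ) + 1) - k) * (pOf n x k - n + 2) * ((k : ℚ) + 2) * (pOf n x k - 1) * ((n : ℚ) - k) *
            (pOf n x k - n + 1))) * T n (pOf n x k - 1) (qOf n k)
      + ev3 PsiNK0 n x (k + 1) * ((((n : ℚ) + 1) - k) * (((n : ℚ) + 1) - k) * (pOf n x k - n + 2) * (pOf n x k - n + 2)) *
          T n (pOf n x k - 1) (qOf n k - 1)
      + ev3 PsiNK1 n x (k + 1) * ((((n : ℚ) + 1) - k) * (((n : ℚ) + 1) - k) * (pOf n x k - n + 2) * (pOf n x k - n + 2)) *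
          T n (pOf n x k) (qOf n k - 1) := by
  have h0 : Tv tabNK n x k 0 = T n (pOf n x k) (qOf n k) := by
    rw [Tv_of_eq (show tabNK[0]? = some (0, 0, 0) from rfl)]; unfold pOf qOf; push_cast; ring_nf
  have h1 : Tv tabNK n x k 1 = T n (pOf n x k + 1) (qOf n k) := by
    rw [Tv_of_eq (show tabNK[1]? = some (0, 1, 0) from rfl)]; unfold pOf qOf; push_cast; ring_nf
  have h2 : Tv tabNK n x k 2 = T (n + 1) (pOf n x k + 3) (qOf n k + 2) := by
    rw [Tv_of_eq (show tabNK[2]? = some (1, 3, 2) from rfl)]; unfold pOf qOf; push_cast; ring_nf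
  have h3 : Tv tabNK n x k 3 = T n (pOf n x k - 1) (qOf n k) := by
    rw [Tv_of_eq (show tabNK[3]? = some (0, -1, 0) from rfl)]; unfold pOf qOf; push_cast; ring_nf
  have h4 : Tv tabNK n x k 4 = T n (pOf n x k - 1) (qOf n k - 1) := by
    rw [Tv_of_eq (show tabNK[4]? = some (0, -1, -1) from rfl)]; unfold pOf qOf; push_cast; ring_nf
  have h5 : Tv tabNK n x k 5 = T n (pOf n x k) (qOf n k - 1) := by
    rw [Tv_of_eq (show tabNK[5]? = some (0, 0, -1) from rfl)]; unfold pOf qOf; push_cast; ring_nf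
  simp only [ENK, lcEval_lcAdd, lcEval_lcSingle, zero_add, ev3_mul3, ev3_lin3, ev3_shift3, ev3_cons, ev3_nil,
    h0, h1, h2, h3, h4, h5]
  unfold pOf qOf
  push_cast
  ring

/-! ### The termwise identity -/

/-- `P ≠ z` for every integer `z` when `x` is not an integer. -/
theorem pOf_ne_int {x : ℚ} (hx : ∀ z : ℤ, x ≠ z) (n k : ℕ) (z : ℤ) : pOf n x k ≠ z := by
  intro h
  apply hx (3 * n - k - z)
  unfold pOf at h
  push_cast
  linarith

set_option maxHeartbeats 4000000 in
/-- **(R-NK) termwise**: for `n = m+3 ≥ 3`, `k ≤ n−1` and non-integral rational `x`,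
`η₁₀·sR (n+1) x k + η₀₀·sR n x k + η₀₁·sR n (x+1) k = g(k+1) − g(k)` (data ×5 on both sides). -/
theorem NK_termwise (m : ℕ) (x : ℚ) (hx : ∀ z : ℤ, x ≠ z) (k : ℕ) (hk : k ≤ m + 2) :
    ev2 etaNK10 (m + 3) x * sR (m + 4) x k + ev2 etaNK00 (m + 3) x * sR (m + 3) x k
      + ev2 etaNK01 (m + 3) x * sR (m + 3) (x + 1) k = gNK (m + 3) x (k + 1) - gNK (m + 3) x k := by
  -- non-vanishing factors
  have hF : (((m + 4).factorial : ℕ) : ℚ) ≠ 0 := by positivity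
  have hk1 : ((k : ℚ) + 1) ≠ 0 := by positivity
  have hk2 : ((k : ℚ) + 2) ≠ 0 := by positivity
  have hkq : (k : ℚ) ≤ (m : ℚ) + 2 := by exact_mod_cast hk
  have hmk4 : ((((m + 3 : ℕ) : ℚ)) + 1 - k) ≠ 0 := by push_cast; intro h; linarith
  have hmk3 : ((((m + 3 : ℕ) : ℚ)) - k) ≠ 0 := by push_cast; intro h; linarith
  have hP0 : pOf (m + 3) x k ≠ 0 := by exact_mod_cast pOf_ne_int hx (m + 3) k 0
  have hP1 : pOf (m + 3) x k - 1 ≠ 0 := sub_ne_zero.2 (by exact_mod_cast pOf_ne_int hx (m + 3) k 1)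
  have hPa : pOf (m + 3) x k - ((m + 3 : ℕ) : ℚ) + 2 ≠ 0 := by
    have := pOf_ne_int hx (m + 3) k (m + 1); push_cast at this ⊢; intro h; apply this; linarith
  have hPb : pOf (m + 3) x k - ((m + 3 : ℕ) : ℚ) + 1 ≠ 0 := by
    have := pOf_ne_int hx (m + 3) k (m + 2); push_cast at this ⊢; intro h; apply this; linarith
  have hPc : pOf (m + 3) x k - 1 - ((m + 3 : ℕ) : ℚ) + 2 ≠ 0 := by
    have := pOf_ne_int hx (m + 3) k (m + 2); push_cast at this ⊢; intro h; apply this; linarith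
  have hPd : pOf (m + 3) x k - 1 - ((m + 3 : ℕ) : ℚ) + 1 ≠ 0 := by
    have := pOf_ne_int hx (m + 3) k (m + 3); push_cast at this ⊢; intro h; apply this; linarith
  have hD0 : ddenNK (m + 3) x k ≠ 0 := by
    unfold ddenNK
    exact mul_ne_zero (mul_ne_zero (mul_ne_zero (mul_ne_zero hk1 hP0) (pow_ne_zero 2 hmk4)) (pow_ne_zero 2 hPa)) hPb
  have hD1 : ddenNK (m + 3) x (k + 1) ≠ 0 := by
    unfold ddenNK
    rw [pOf_ksucc]
    push_cast
    refine mul_ne_zero (mul_ne_zero (mul_ne_zero (mul_ne_zero ?_ hP1) (pow_ne_zero 2 ?_)) (pow_ne_zero 2 ?_)) ?_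
    · intro h; apply hk2; linarith
    · push_cast at hmk3; intro h; apply hmk3; linarith
    · push_cast at hPc; intro h; apply hPc; linarith
    · push_cast at hPd; intro h; apply hPd; linarith
  -- the certificate values times their denominators
  have eG0 : gNK (m + 3) x k * ddenNK (m + 3) x k = hR (m + 3) x k *
      (ev3 PsiNK0 ((m + 3 : ℕ) : ℚ) x (k : ℚ) * T (m + 3) (pOf (m + 3) x k) (qOf (m + 3) k)
        + ev3 PsiNK1 ((m + 3 : ℕ) : ℚ) x (k : ℚ) * T (m + 3) (pOf (m + 3) x k + 1) (qOf (m + 3) k)) := by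
    unfold gNK; exact div_mul_cancel₀ _ hD0
  have eG1 : gNK (m + 3) x (k + 1) * ddenNK (m + 3) x (k + 1) = hR (m + 3) x (k + 1) *
      (ev3 PsiNK0 ((m + 3 : ℕ) : ℚ) x ((k + 1 : ℕ) : ℚ) * T (m + 3) (pOf (m + 3) x k - 1) (qOf (m + 3) k - 1)
        + ev3 PsiNK1 ((m + 3 : ℕ) : ℚ) x ((k + 1 : ℕ) : ℚ) * T (m + 3) (pOf (m + 3) x k) (qOf (m + 3) k - 1)) := by
    unfold gNK
    rw [div_mul_cancel₀ _ hD1, pOf_ksucc, qOf_ksucc, show pOf (m + 3) x k - 1 + 1 = pOf (m + 3) x k by ring]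
  -- the kernel identity and the unit expansions
  have key := ENK_eval_zero (m + 3) (by omega) x hx k (by omega)
  rw [lcEval_ENK] at key
  have u1 := FNK_hR_up m x k
  have u2 := FNK_hR_00 m x k
  have u3 := FNK_hR_x m x k
  have u4 := FNK_hR_k m x k
  -- canonical forms
  unfold sR
  rw [pOf_nsucc, qOf_nsucc, pOf_xsucc]
  unfold ddenNK at eG0 eG1
  rw [pOf_ksucc] at eG1
  push_cast at key eG0 eG1 u1 u2 u3 u4 hmk4 hmk3 hPa hPb hPc hPd ⊢
  set P := pOf (m + 3) x k with hP
  set Q := qOf (m + 3) k with hQ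
  set U := uNK m x k with hU
  set F : ℚ := (((m + 4).factorial : ℕ) : ℚ) with hFdef
  set η10 := ev2 etaNK10 ((m : ℚ) + 3) x
  set η00 := ev2 etaNK00 ((m : ℚ) + 3) x
  set η01 := ev2 etaNK01 ((m : ℚ) + 3) x
  set Ψ0 := ev3 PsiNK0 ((m : ℚ) + 3) x k
  set Ψ1 := ev3 PsiNK1 ((m : ℚ) + 3) x k
  set Ψ0s := ev3 PsiNK0 ((m : ℚ) + 3) x ((k : ℚ) + 1)
  set Ψ1s := ev3 PsiNK1 ((m : ℚ) + 3) x ((k : ℚ) + 1)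
  set T132 := T (m + 4) (P + 3) (Q + 2)
  set T000 := T (m + 3) P Q
  set T010 := T (m + 3) (P + 1) Q
  set T0m10 := T (m + 3) (P - 1) Q
  set T0m1m1 := T (m + 3) (P - 1) (Q - 1)
  set T00m1 := T (m + 3) P (Q - 1)
  set h1 := hR (m + 4) x k
  set h0 := hR (m + 3) x k
  set h0x := hR (m + 3) (x + 1) k
  set h0k := hR (m + 3) x (k + 1)
  set g0 := gNK (m + 3) x k
  set g1 := gNK (m + 3) x (k + 1)
  -- the certificate values with the unit attached (common factors cancelled)
  have hA2 : P * (((m : ℚ) + 4) - k) * (P - m - 1) * (P - m - 2) ≠ 0 := by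
    refine mul_ne_zero (mul_ne_zero (mul_ne_zero hP0 ?_) ?_) ?_
    · intro h; apply hmk4; linarith
    · intro h; apply hPa; linarith
    · intro h; apply hPb; linarith
  have hg0 : F * g0 * (((k : ℚ) + 1) * (((m : ℚ) + 4) - k) * (P - m - 1)) = U * (Ψ0 * T000 + Ψ1 * T010) := by
    apply mul_right_cancel₀ hA2
    linear_combination F * eG0 + (Ψ0 * T000 + Ψ1 * T010) * u2
  have hB : (((m : ℚ) + 3) - k) * (P - m - 2) * (P - m - 3) ≠ 0 := by
    refine mul_ne_zero (mul_ne_zero ?_ ?_) ?_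
    · intro h; apply hmk3; linarith
    · intro h; apply hPb; linarith
    · intro h; apply hPd; linarith
  have hg1 : F * ((k : ℚ) + 1) * g1 * (((k : ℚ) + 2) * (P - 1) * (((m : ℚ) + 3) - k) * (P - m - 2)) =
      -(U * ((((m : ℚ) + 4) - k) * (P - m - 1)) * (Ψ0s * T0m1m1 + Ψ1s * T00m1)) := by
    apply mul_right_cancel₀ hB
    linear_combination F * ((k : ℚ) + 1) * eG1 + (Ψ0s * T0m1m1 + Ψ1s * T00m1) * u4
  -- clear the remaining denominators `F·(k+1)·Dz` and conclude with the kernel identity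
  have hM : F * ((k : ℚ) + 1) * ((((m : ℚ) + 4) - k) * (P - m - 1) * ((k : ℚ) + 2) * (P - 1) *
      (((m : ℚ) + 3) - k) * (P - m - 2)) ≠ 0 := by
    refine mul_ne_zero (mul_ne_zero hF hk1) ?_
    refine mul_ne_zero (mul_ne_zero (mul_ne_zero (mul_ne_zero (mul_ne_zero ?_ ?_) hk2) hP1) ?_) ?_
    · intro h; apply hmk4; linarith
    · intro h; apply hPa; linarith
    · intro h; apply hmk3; linarith
    · intro h; apply hPb; linarith
  apply mul_left_cancel₀ hM
  linear_combination
    (((k : ℚ) + 1) * ((((m : ℚ) + 4) - k) * (P - m - 1) * ((k : ℚ) + 2) * (P - 1) * (((m : ℚ) + 3) - k) *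
      (P - m - 2)) * η10 * T132) * u1
    + (((k : ℚ) + 1) * ((((m : ℚ) + 4) - k) * (P - m - 1) * ((k : ℚ) + 2) * (P - 1) * (((m : ℚ) + 3) - k) *
      (P - m - 2)) * η00 * T000) * u2
    + (((k : ℚ) + 1) * ((((m : ℚ) + 4) - k) * (P - m - 1) * ((k : ℚ) + 2) * (P - 1) * (((m : ℚ) + 3) - k) *
      (P - m - 2)) * η01 * T0m10) * u3
    + (-((((m : ℚ) + 4) - k) * (P - m - 1))) * hg1
    + (((k : ℚ) + 2) * (P - 1) * (((m : ℚ) + 3) - k) * (P - m - 2)) * hg0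
    + U * key

end VIMInner.ModRed

end Summit.KontsevichZagierPeriods.Zeta5Search.Certificates
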